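import Summits.ResolutionOfSingularities.ResolutionOfSingularities.Theorems.DeltaCutLawB
import HarnessLib

/-!
# DeltaCutAdapted — decomp-res node «DeltaCut» (lens-6 g23, critic row 181 CLEARED DECIDED +1 · MAP +1 (lane (b))),
tree file 3/8 of the node

Content VERBATIM from the decomp-res lens-6 g23 node `HOME/decomp-res-lens-6/g23/DeltaCut.lean` (pin a85f83d5) /
`DeltaCutJ.lean` (9b3a0295); imports the
landed tree only, carries nothing; HOME = run/shared/lean/pub/decomp-res; critic row 181 CLEARED DECIDED +1 · MAP +1
(lane (b)); landing orders NODE-g23.md §10 /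
INBOX :883 — provenance, critic text and the lens header in full in the first file of the node, `DeltaCutLaw`.
Namespace `…Theorems.DeltaCutClasses`;
`--supports stmt-ResolutionOfSingularities-26971`; cone-free.

## This file

§Adapted, §RingSection, §PointOfPrime — ADAPTED DIGITS, RING SECTIONS, CHART POINTS (kernel): `adaptedSubring n s̄`;
`exists_adapted_expansion` (graded, every precision); `exists_adapted_layers` — EVERY `f ∈ 𝔪^n` has a presentation
in the law's format; `exists_ring_section_of_charP` — for EVERY local ring of prime characteristic `p` and every `n
≥ 1` a RING section `κ →+* R/𝔪^n` with adapted lifts exists (`Literature.RingTheory.Smooth.formallySmooth_of_charP`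
+ Mathlib `Algebra.FormallySmooth.liftOfSurjective`; NO perfectness, no completeness, no Cohen structure theorem);
`exists_point_of_reesChart_prime` — every prime `𝔴` of a Rees chart ring lying over `𝔪_s` is the local ring of a
POINT `x'` of the blowing up over `s`, with `χ : chartRing c j →+* 𝒪_{X',x'}` a localisation at `𝔴` COMPATIBLE WITH `π♯`.

[WRITER NOTE (decomp-res writer g11): file split only (tree files ≤ 400 lines); `noncomputable section`, universe,
namespace, sections, section
variables, the `open` lines and every declaration exactly as in the lens; no instance, no notation, no include/omit added.]

(Sources: Hironaka1967 (characteristic polyhedra); CossartJannsenSaito2020 Def. 3.13 / Thm. 3.14 p. 129, Ch. 8 pp.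
128–135, Thm. 9.6 p. 136; Hironaka1970 (near points / vertices); CossartPiltant2008 §2; Giraud1975; EGAIV4 §16–§17
(formal smoothness); StacksProject 0804 / 0BIQ / 031I; Matsumura1987 §28.)
-/

noncomputable section

open CategoryTheory CategoryTheory.Limits AlgebraicGeometry TopologicalSpace IsLocalRing
open Literature.AlgebraicGeometry.Resolution
universe u

open Summit.ResolutionOfSingularities.ResolutionOfSingularities.Theorems.TwistCutClasses
open Summit.ResolutionOfSingularities.ResolutionOfSingularities.Theorems.LightCutClasses

namespace Summit.ResolutionOfSingularities.ResolutionOfSingularities.Theorems.DeltaCutClasses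

section Adapted

variable {R : Type*} [CommRing R] [IsLocalRing R]

/-! ### Adapted digits: the subring `A_{s̄}` and the EXISTENCE of adapted presentations (N-DESIGN §3, trap T4) -/

/-- The ADAPTED elements for a ring section `s̄ : κ → R ⧸ 𝔪^n`: the equaliser of `mk_n` and `s̄ ∘ residue`.  It is a SUBRING
(both are ring maps) — so adapted coefficients may be added and multiplied freely. DEFINITION. -/
def adaptedSubring (n : ℕ) (sbar : ResidueField R →+* R ⧸ (maximalIdeal R) ^ n) : Subring R :=
  RingHom.eqLocus (Ideal.Quotient.mk ((maximalIdeal R) ^ n)) (sbar.comp (residue R))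

/-- `mem_adaptedSubring_iff`: Auxiliary step of this node's calculus, VERBATIM from the lens file (see the module
docstring); the statement is its type. [folklore] -/
theorem mem_adaptedSubring_iff {n : ℕ} {sbar : ResidueField R →+* R ⧸ (maximalIdeal R) ^ n} {b : R} :
    b ∈ adaptedSubring n sbar ↔ Ideal.Quotient.mk ((maximalIdeal R) ^ n) b = sbar (residue R b) := Iff.rfl

/-- Every residue class has an adapted representative (this is where the SECTION property is used). [elementary] [folklore] -/
theorem exists_adapted_lift {n : ℕ} (sbar : ResidueField R →+* R ⧸ (maximalIdeal R) ^ n)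
    (hsbar : ∀ β : ResidueField R, ∃ r : R, Ideal.Quotient.mk ((maximalIdeal R) ^ n) r = sbar β ∧ residue R r = β)
    (β : ResidueField R) : ∃ r ∈ adaptedSubring n sbar, residue R r = β := by
  obtain ⟨r, hr1, hr2⟩ := hsbar β
  exact ⟨r, by rw [mem_adaptedSubring_iff, hr1, hr2], hr2⟩

/-- Two adapted elements with the same residue agree modulo `𝔪^n` (the digits are RIGID). [elementary] [folklore] -/
theorem sub_mem_pow_of_adapted {n : ℕ} {sbar : ResidueField R →+* R ⧸ (maximalIdeal R) ^ n} {b b' : R}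
    (hb : b ∈ adaptedSubring n sbar) (hb' : b' ∈ adaptedSubring n sbar) (h : residue R b = residue R b') :
    b - b' ∈ (maximalIdeal R) ^ n := by
  rw [← Ideal.Quotient.eq, mem_adaptedSubring_iff.1 hb, mem_adaptedSubring_iff.1 hb', h]

/-- **EXISTENCE OF ADAPTED EXPANSIONS (graded).**  `𝔪 = (c₁,…,c_d)`, `s̄` a ring section with adapted lifts.  Every
`g ∈ 𝔪^M` has, for every precision `N`, a polynomial expansion `g ≡ F(c) (mod 𝔪^{M+N})` whose coefficients are ALL adapted
and whose monomials all have degree `≥ M`.  (Apply to `g = f ∈ 𝔪^n` with `M = N = n` to get ALL the layers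
`G_0, …, G_{n-1}` of `delta_law_at` — `exists_adapted_layers`; `Finsupp.degree_eq_sum` converts degrees.) [new;
elementary] [folklore] -/
theorem exists_adapted_expansion {d : ℕ} (c : Fin d → R) (hc : Ideal.span (Set.range c) = maximalIdeal R)
    {n : ℕ} (sbar : ResidueField R →+* R ⧸ (maximalIdeal R) ^ n)
    (hsbar : ∀ β : ResidueField R, ∃ r : R, Ideal.Quotient.mk ((maximalIdeal R) ^ n) r = sbar β ∧ residue R r = β)
    (N M : ℕ) (g : R) (hg : g ∈ (maximalIdeal R) ^ M) :
    ∃ F : MvPolynomial (Fin d) R, (∀ m, F.coeff m ∈ adaptedSubring n sbar) ∧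
      (∀ m ∈ F.support, M ≤ Finsupp.degree m) ∧ g - MvPolynomial.eval c F ∈ (maximalIdeal R) ^ (M + N) := by
  classical
  induction N generalizing M g with
  | zero =>
    refine ⟨0, fun m => ?_, fun m hm => ?_, by simpa using hg⟩
    · rw [MvPolynomial.coeff_zero]; exact zero_mem _
    · simp at hm
  | succ N ih =>
    induction M generalizing g with
    | zero =>
      obtain ⟨r, hrA, hrβ⟩ := exists_adapted_lift sbar hsbar (residue R g)
      have h1 : g - r ∈ (maximalIdeal R) ^ 1 := by
        rw [pow_one, ← IsLocalRing.residue_eq_zero_iff, map_sub, hrβ, sub_self]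
      obtain ⟨F', hF'A, -, hF'⟩ := ih 1 (g - r) h1
      refine ⟨MvPolynomial.C r + F', fun m => ?_, fun m _ => Nat.zero_le _, ?_⟩
      · rw [MvPolynomial.coeff_add, MvPolynomial.coeff_C]
        refine add_mem ?_ (hF'A m)
        split_ifs
        · exact hrA
        · exact zero_mem _
      · rw [map_add, MvPolynomial.eval_C, ← sub_sub, show 0 + (N + 1) = 1 + N from by omega]
        exact hF'
    | succ M ihM =>
      have hpow : (maximalIdeal R) ^ (M + 1) = (maximalIdeal R) ^ M • Ideal.span (Set.range c) := by
        rw [Ideal.smul_eq_mul, hc, pow_succ]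
      obtain ⟨a, ha, hsum⟩ := (Submodule.mem_ideal_smul_span_iff_exists_sum ((maximalIdeal R) ^ M) c g).1
        (by rw [← hpow]; exact hg)
      choose F hFA hFdeg hFrem using fun j => ihM (a j) (ha j)
      refine ⟨∑ j, MvPolynomial.X j * F j, fun m => ?_, fun m hm => ?_, ?_⟩
      · rw [MvPolynomial.coeff_sum]
        refine sum_mem fun j _ => ?_
        rw [MvPolynomial.coeff_X_mul']
        split_ifs
        · exact hFA j _
        · exact zero_mem _
      · rw [MvPolynomial.mem_support_iff, MvPolynomial.coeff_sum] at hm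
        obtain ⟨j, -, hj⟩ := Finset.exists_ne_zero_of_sum_ne_zero hm
        rw [MvPolynomial.coeff_X_mul'] at hj
        split_ifs at hj with hjm
        · have hdeg := hFdeg j (m - Finsupp.single j 1) (MvPolynomial.mem_support_iff.2 hj)
          have hle : Finsupp.single j 1 ≤ m :=
            Finsupp.single_le_iff.2 (Nat.one_le_iff_ne_zero.2 (Finsupp.mem_support_iff.1 hjm))
          have hm_eq : m = (m - Finsupp.single j 1) + Finsupp.single j 1 := (tsub_add_cancel_of_le hle).symm
          have hdm : Finsupp.degree m = Finsupp.degree (m - Finsupp.single j 1) + 1 := by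
            conv_lhs => rw [hm_eq]
            rw [map_add, Finsupp.degree_single]
          omega
        · exact absurd rfl hj
      · have hsum' : ∑ j, c j * a j = g := by
          rw [← hsum, Finsupp.sum_fintype _ _ (fun j => zero_smul R (c j))]
          exact Finset.sum_congr rfl fun j _ => by rw [smul_eq_mul, mul_comm]
        have heval : MvPolynomial.eval c (∑ j, MvPolynomial.X j * F j) = ∑ j, c j * MvPolynomial.eval c (F j) := by
          rw [map_sum]; exact Finset.sum_congr rfl fun j _ => by rw [map_mul, MvPolynomial.eval_X]
        have hdiff : g - MvPolynomial.eval c (∑ j, MvPolynomial.X j * F j) =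
            ∑ j, c j * (a j - MvPolynomial.eval c (F j)) := by
          rw [heval, ← hsum', ← Finset.sum_sub_distrib]
          exact Finset.sum_congr rfl fun j _ => by ring
        rw [hdiff, show M + 1 + (N + 1) = 1 + (M + (N + 1)) from by omega, pow_add, pow_one]
        refine Ideal.sum_mem _ fun j _ => Ideal.mul_mem_mul ?_ (hFrem j)
        rw [← hc]; exact Ideal.subset_span ⟨j, rfl⟩

omit [IsLocalRing R] in
/-- `∏ c^e ∈ (c)^{|e|}`. [elementary] [folklore] -/
theorem prod_pow_mem_span_pow {d : ℕ} (c : Fin d → R) (e : Fin d → ℕ) :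
    ∏ j, c j ^ e j ∈ Ideal.span (Set.range c) ^ (∑ j, e j) := by
  rw [← Finset.prod_pow_eq_pow_sum]
  exact Ideal.prod_mem_prod fun j _ => Ideal.pow_mem_pow (Ideal.subset_span (Set.mem_range_self j)) _

/-- **ADAPTED LAYERS in the format of `chart_expansion_layers` / `delta_law_at`** (all layers, from `k = 0`).  Every `f ∈ 𝔪^n`
has, for a ring section with adapted lifts, layer index sets `E k` (`|e| = n + k`), ADAPTED coefficients `b k e`, and
`f − Σ_{k=0}^{n-1} Σ_{e ∈ E k} b_{k,e} c^e ∈ (c)^{2n}` — exactly the hypotheses `hE`, `hb`, `hfa` of the law.  (No unit, no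
privileged direction: the initial form is layer `0`.) [new; elementary bookkeeping over `exists_adapted_expansion`]
[folklore] -/
theorem exists_adapted_layers {d : ℕ} (c : Fin d → R) (hc : Ideal.span (Set.range c) = maximalIdeal R)
    {n : ℕ} (sbar : ResidueField R →+* R ⧸ (maximalIdeal R) ^ n)
    (hsbar : ∀ β : ResidueField R, ∃ r : R, Ideal.Quotient.mk ((maximalIdeal R) ^ n) r = sbar β ∧ residue R r = β)
    (f : R) (hf : f ∈ (maximalIdeal R) ^ n) :
    ∃ (E : ℕ → Finset (Fin d → ℕ)) (b : ℕ → (Fin d → ℕ) → R),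
      (∀ k, ∀ e ∈ E k, ∑ j, e j = n + k) ∧
      (∀ k e, Ideal.Quotient.mk ((maximalIdeal R) ^ n) (b k e) = sbar (residue R (b k e))) ∧
      f - ∑ k ∈ Finset.range n, ∑ e ∈ E k, b k e * ∏ j, c j ^ e j ∈ Ideal.span (Set.range c) ^ (n + n) := by
  classical
  obtain ⟨F, hFA, hFdeg, hFrem⟩ := exists_adapted_expansion c hc sbar hsbar n n f hf
  refine ⟨fun k => ((F.support.filter fun m : Fin d →₀ ℕ => Finsupp.degree m = n + k).image fun m : Fin d →₀ ℕ => (⇑m : Fin d → ℕ)),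
    fun _ e => F.coeff (Finsupp.equivFunOnFinite.symm e), ?_, fun _ e => hFA _, ?_⟩
  · intro k e he
    obtain ⟨m, hm, rfl⟩ := Finset.mem_image.1 he
    rw [← Finsupp.degree_eq_sum]; exact (Finset.mem_filter.1 hm).2
  · have hlayer : ∀ k, ∑ e ∈ (F.support.filter fun m : Fin d →₀ ℕ => Finsupp.degree m = n + k).image (fun m : Fin d →₀ ℕ => (⇑m : Fin d → ℕ)),
        F.coeff (Finsupp.equivFunOnFinite.symm e) * ∏ j, c j ^ e j
        = ∑ m ∈ F.support.filter (fun m : Fin d →₀ ℕ => Finsupp.degree m = n + k), F.coeff m * ∏ j, c j ^ m j := by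
      intro k
      rw [Finset.sum_image fun (m : Fin d →₀ ℕ) _ (m' : Fin d →₀ ℕ) _ (h : (⇑m : Fin d → ℕ) = ⇑m') =>
        Finsupp.ext fun j => congrFun h j]
      exact Finset.sum_congr rfl fun m _ => by rw [Finsupp.equivFunOnFinite_symm_coe]
    have heval : MvPolynomial.eval c F = ∑ m ∈ F.support, F.coeff m * ∏ j, c j ^ m j := MvPolynomial.eval_eq' c F
    have hsplit : ∑ m ∈ F.support, F.coeff m * ∏ j, c j ^ m j =
        ∑ m ∈ F.support.filter (fun m : Fin d →₀ ℕ => Finsupp.degree m < n + n), F.coeff m * ∏ j, c j ^ m j +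
        ∑ m ∈ F.support.filter (fun m : Fin d →₀ ℕ => ¬ Finsupp.degree m < n + n), F.coeff m * ∏ j, c j ^ m j :=
      (Finset.sum_filter_add_sum_filter_not _ _ _).symm
    have hhigh : ∑ m ∈ F.support.filter (fun m : Fin d →₀ ℕ => ¬ Finsupp.degree m < n + n), F.coeff m * ∏ j, c j ^ m j ∈
        Ideal.span (Set.range c) ^ (n + n) := by
      refine Ideal.sum_mem _ fun m hm => Ideal.mul_mem_left _ _ ?_
      have hdeg : n + n ≤ ∑ j, m j := by rw [← Finsupp.degree_eq_sum]; exact not_lt.1 (Finset.mem_filter.1 hm).2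
      exact Ideal.pow_le_pow_right hdeg (prod_pow_mem_span_pow c m)
    have hmaps : ∀ m ∈ F.support.filter (fun m : Fin d →₀ ℕ => Finsupp.degree m < n + n),
        (fun m : Fin d →₀ ℕ => Finsupp.degree m - n) m ∈ Finset.range n := by
      intro m hm
      have h1 := hFdeg m (Finset.mem_filter.1 hm).1
      have h2 := (Finset.mem_filter.1 hm).2
      simp only [Finset.mem_range]; omega
    have hlow : ∑ m ∈ F.support.filter (fun m : Fin d →₀ ℕ => Finsupp.degree m < n + n), F.coeff m * ∏ j, c j ^ m j =
        ∑ k ∈ Finset.range n, ∑ m ∈ F.support.filter (fun m : Fin d →₀ ℕ => Finsupp.degree m = n + k),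
          F.coeff m * ∏ j, c j ^ m j := by
      rw [← Finset.sum_fiberwise_of_maps_to hmaps]
      refine Finset.sum_congr rfl fun k hk => Finset.sum_congr ?_ fun _ _ => rfl
      ext m
      simp only [Finset.mem_filter, Finset.mem_range, MvPolynomial.mem_support_iff] at hk ⊢
      constructor
      · rintro ⟨⟨h1, h2⟩, h3⟩
        have h4 := hFdeg m (MvPolynomial.mem_support_iff.mpr h1)
        exact ⟨h1, by omega⟩
      · rintro ⟨h1, h2⟩; exact ⟨⟨h1, by omega⟩, by omega⟩
    have hcomb : f - ∑ k ∈ Finset.range n,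
        ∑ e ∈ (F.support.filter fun m : Fin d →₀ ℕ => Finsupp.degree m = n + k).image (fun m : Fin d →₀ ℕ => (⇑m : Fin d → ℕ)),
          F.coeff (Finsupp.equivFunOnFinite.symm e) * ∏ j, c j ^ e j =
        (f - MvPolynomial.eval c F) +
        ∑ m ∈ F.support.filter (fun m : Fin d →₀ ℕ => ¬ Finsupp.degree m < n + n), F.coeff m * ∏ j, c j ^ m j := by
      rw [heval, hsplit, hlow, Finset.sum_congr rfl fun k _ => hlayer k]; ring
    rw [hcomb]
    refine add_mem ?_ hhigh
    rw [hc]; exact hFrem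

end Adapted

section RingSection

/-! ### (g23 · X1) RING SECTIONS `s̄ : κ →+* R ⧸ 𝔪ⁿ` WITH ADAPTED LIFTS EXIST FOR EVERY LOCAL RING OF PRIME CHARACTERISTIC
(discharges R-a of N-DESIGN: `IsDeltaLight` is never vacuous for want of `s̄`; imperfect residue fields are covered; no Cohen
structure theorem, no completeness, no perfectness) -/

/-- **Ring sections exist in characteristic `p`.**  For a local ring `R` of prime characteristic `p` and `n ≥ 1` there is a ring
section `s̄ : κ(R) →+* R ⧸ 𝔪ⁿ` of the residue map such that every `β ∈ κ` has a lift `r ∈ R` ADAPTED to it (`r mod 𝔪ⁿ = s̄ β`,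
`r̄ = β`).  Proof: `κ` is formally smooth over `𝔽_p` (tree `formallySmooth_of_charP` = Matsumura Thm 26.9 via `p`-bases) and
`R ⧸ 𝔪ⁿ → κ` is a surjection of `𝔽_p`-algebras with nilpotent kernel, so the identity of `κ` lifts (Mathlib
`Algebra.FormallySmooth.liftOfSurjective`). [new] (Sources: Matsumura1986, Thm 26.9; Matsumura1986, Thm 28.10.) -/
theorem exists_ring_section_of_charP {R : Type*} [CommRing R] [IsLocalRing R] (p : ℕ) [Fact p.Prime] [CharP R p]
    (n : ℕ) (hn : 1 ≤ n) :
    ∃ sbar : ResidueField R →+* R ⧸ (maximalIdeal R) ^ n,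
      ∀ β, ∃ r : R, Ideal.Quotient.mk ((maximalIdeal R) ^ n) r = sbar β ∧ residue R r = β := by
  classical
  letI : Algebra (ZMod p) R := ZMod.algebra R p
  haveI : CharP (ResidueField R) p :=
    (CharP.charP_iff_prime_eq_zero Fact.out).mpr (by
      rw [← map_natCast (residue R), CharP.cast_eq_zero, map_zero])
  haveI : Algebra.FormallySmooth (ZMod p) (ResidueField R) :=
    Literature.RingTheory.Smooth.formallySmooth_of_charP p (ResidueField R)
  have hle : (maximalIdeal R) ^ n ≤ maximalIdeal R := Ideal.pow_le_self (Nat.one_le_iff_ne_zero.mp hn)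
  -- the reduction map `R ⧸ 𝔪^n → κ(R)` as a `ZMod p`-algebra map
  let g : (R ⧸ (maximalIdeal R) ^ n) →ₐ[ZMod p] ResidueField R := Ideal.Quotient.factorₐ (ZMod p) hle
  have hgmk : ∀ r : R, g (Ideal.Quotient.mk _ r) = residue R r := fun r => rfl
  have hg : Function.Surjective g := by
    intro x
    obtain ⟨r, rfl⟩ := Ideal.Quotient.mk_surjective x
    exact ⟨Ideal.Quotient.mk _ r, rfl⟩
  have hg' : IsNilpotent (RingHom.ker (g : (R ⧸ (maximalIdeal R) ^ n) →+* ResidueField R)) := by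
    refine ⟨n, ?_⟩
    have hker : RingHom.ker (g : (R ⧸ (maximalIdeal R) ^ n) →+* ResidueField R) ≤
        (maximalIdeal R).map (Ideal.Quotient.mk ((maximalIdeal R) ^ n)) := by
      intro x hx
      obtain ⟨r, rfl⟩ := Ideal.Quotient.mk_surjective x
      rw [RingHom.mem_ker] at hx
      change g (Ideal.Quotient.mk _ r) = 0 at hx
      rw [hgmk, residue_eq_zero_iff] at hx
      exact Ideal.mem_map_of_mem _ hx
    rw [Submodule.zero_eq_bot, ← le_bot_iff]
    calc RingHom.ker (g : (R ⧸ (maximalIdeal R) ^ n) →+* ResidueField R) ^ n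
        ≤ ((maximalIdeal R).map (Ideal.Quotient.mk ((maximalIdeal R) ^ n))) ^ n := Ideal.pow_right_mono hker n
      _ = ((maximalIdeal R) ^ n).map (Ideal.Quotient.mk ((maximalIdeal R) ^ n)) := by rw [Ideal.map_pow]
      _ = ⊥ := by rw [Ideal.map_quotient_self]
      _ ≤ ⊥ := le_rfl
  let ψ := Algebra.FormallySmooth.liftOfSurjective (AlgHom.id (ZMod p) (ResidueField R)) g hg hg'
  refine ⟨ψ.toRingHom, fun β => ?_⟩
  obtain ⟨r, hr⟩ := Ideal.Quotient.mk_surjective (ψ β)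
  refine ⟨r, hr, ?_⟩
  have h := Algebra.FormallySmooth.liftOfSurjective_apply (AlgHom.id (ZMod p) (ResidueField R)) g hg hg' β
  rw [AlgHom.id_apply] at h
  rw [← hgmk, hr]
  exact h

end RingSection

section PointOfPrime

variable {X' X : Scheme.{u}} {π : X' ⟶ X} {J : X.IdealSheafData}

set_option maxHeartbeats 800000 in
-- the comparison with `Proj` over `Spec 𝒪_{X,s}` elaborates large terms (as in `IsBlowup.exists_point_of_blowupAlgebra_prime`)

/-! ### (g23 · X2) EVERY PRIME OF A REES CHART RING OVER `𝔪_s` IS CENTRED AT A POINT OF THE BLOWING UP, COMPATIBLY WITH `π♯`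
(the point-producing converse of the tree's `IsBlowup.exists_reesChart_stalk`, needed by the converse of the δ-law) -/

/-- **Every prime `𝔴` of the Rees chart ring `𝒪_{X,s}[(c)/c_j]` lying over `𝔪_s` is the local ring of a point `x'` of the
blowing up over `s`**, through a ring map `χ : 𝒪_{X,s}[(c)/c_j] → 𝒪_{X',x'}` with `χ ∘ (structure map) = π♯_{x'}` presenting
`𝒪_{X',x'}` as the localisation at `𝔴`.  (The chart morphism `Spec 𝒪_{X,s}[(c)/c_j] → Proj ≅ X' ×_X Spec 𝒪_{X,s} → X'` of the
tree's `IsBlowup.exists_point_of_blowupAlgebra_prime`, followed by the tree's `exists_stalk_ringHom_of_chart`.)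
[folklore] (Sources: StacksProject, Tag 0804; StacksProject, Tag 0805.) -/
theorem exists_point_of_reesChart_prime (hπ : IsBlowup π J) (s : X) {k : ℕ}
    (c : Fin k → X.presheaf.stalk s) (hc : Ideal.span (Set.range c) = stalkIdeal J s) (j : Fin k)
    (𝔴 : PrimeSpectrum (chartRing c j))
    (h𝔴 : 𝔴.asIdeal.comap (chartBase c j) = maximalIdeal (X.presheaf.stalk s)) :
    ∃ (x' : X') (hx : π x' = s) (χ : chartRing c j →+* X'.presheaf.stalk x'),
      (∀ a, χ (chartBase c j ((X.presheaf.stalkCongr (.of_eq hx)).hom a)) = (π.stalkMap x').hom a) ∧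
      @IsLocalization.AtPrime _ _ (X'.presheaf.stalk x') _ χ.toAlgebra 𝔴.asIdeal _ := by
  classical
  have hcj : ∀ j, c j ∈ Ideal.span (Set.range c) := fun j =>
    Ideal.mem_span_range_self (f := c) (x := j)
  haveI : Flat (X.fromSpecStalk s) := flat_fromSpecStalk X s
  -- the base change `P = X' ×_X Spec 𝒪_{X,s} → Spec 𝒪_{X,s}` is a blowing up along `(J_s)~ = (c)~`
  have hP : IsBlowup (pullback.snd π (X.fromSpecStalk s))
      (affineBlowup.idealSheaf (Ideal.span (Set.range c))) := by
    have h := hπ.pullback_snd_of_flat (X.fromSpecStalk s)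
    rwa [comap_fromSpecStalk_eq_affineBlowupIdealSheaf, ← hc] at h
  obtain ⟨e, he, -⟩ := (affineBlowup.isBlowup (Ideal.span (Set.range c))).unique hP
  let w : Spec (.of (chartRing c j)) := 𝔴
  -- `w` lies over the closed point of `Spec 𝒪_{X,s}`
  have hw : (Spec.map (CommRingCat.ofHom (chartBase c j))).base w = closedPoint (X.presheaf.stalk s) := by
    rw [Spec.map_base]
    change PrimeSpectrum.comap (chartBase c j) w = closedPoint (X.presheaf.stalk s)
    ext a
    change chartBase c j a ∈ 𝔴.asIdeal ↔ a ∈ (closedPoint (X.presheaf.stalk s)).asIdeal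
    rw [show (closedPoint (X.presheaf.stalk s)).asIdeal = maximalIdeal _ from rfl, ← h𝔴, Ideal.mem_comap]
  -- the chart morphism `q : Spec B_j → Proj ≅ P → X'` and the point `x' = q w`
  let q : Spec (.of (chartRing c j)) ⟶ X' :=
    (affineBlowup.chartι (c j) (hcj j) ≫ e.hom) ≫ pullback.fst π (X.fromSpecStalk s)
  have hqπ : q ≫ π = Spec.map (CommRingCat.ofHom (chartBase c j)) ≫ X.fromSpecStalk s := by
    rw [Category.assoc, pullback.condition, Category.assoc, reassoc_of% he, ← Category.assoc,
      affineBlowup.chartι_π (c j) (hcj j)]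
  have hx : π (q w) = s := by
    have h1 : π (q w) = (q ≫ π) w := (Scheme.Hom.comp_apply q π w).symm
    rw [h1, hqπ, Scheme.Hom.comp_apply, hw, Scheme.fromSpecStalk_closedPoint]
  -- `q` induces an isomorphism of local rings at `w`
  have h1 := isIso_stalkMap_pullback_fst_fromSpecStalk π s
    ((affineBlowup.chartι (c j) (hcj j) ≫ e.hom) w)
  haveI : IsOpenImmersion (affineBlowup.chartι (c j) (hcj j) ≫ e.hom) := inferInstance
  have h2 : IsIso ((affineBlowup.chartι (c j) (hcj j) ≫ e.hom).stalkMap w) := inferInstance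
  haveI : IsIso (q.stalkMap w) := by
    change IsIso (((affineBlowup.chartι (c j) (hcj j) ≫ e.hom) ≫ pullback.fst π (X.fromSpecStalk s)).stalkMap w)
    rw [Scheme.Hom.stalkMap_comp]
    exact @IsIso.comp_isIso _ _ _ _ _ _ _ h1 h2
  -- the structure map read through the stalk at `π (q w)` (`= s` pointwise, not definitionally)
  let φ' : X.presheaf.stalk (π (q w)) ⟶ CommRingCat.of (chartRing c j) :=
    (X.presheaf.stalkCongr (.of_eq hx)).hom ≫ CommRingCat.ofHom (chartBase c j)
  have hsq : q ≫ π = Spec.map φ' ≫ X.fromSpecStalk (π (q w)) := by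
    change _ = Spec.map ((X.presheaf.stalkCongr (.of_eq hx)).hom ≫ CommRingCat.ofHom (chartBase c j)) ≫ _
    rw [hqπ, Spec.map_comp, Category.assoc, TopCat.Presheaf.stalkCongr_hom,
      Scheme.SpecMap_stalkSpecializes_fromSpecStalk]
    rfl
  obtain ⟨χ, hχ, hloc, -⟩ := exists_stalk_ringHom_of_chart π (q w) φ' q w rfl hsq
  refine ⟨q w, hx, χ, fun a => ?_, hloc⟩
  have h := hχ a
  simp only [φ', CommRingCat.hom_comp, RingHom.comp_apply] at h
  exact h

end PointOfPrime

end Summit.ResolutionOfSingularities.ResolutionOfSingularities.Theorems.DeltaCutClasses
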